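import Literature.Analysis.ODE.HighOrderEnclosure
import HarnessLib

/-!
# Chains of validated steps: from per-step enclosure theorems to the whole time grid

Topic `Literature/Analysis/ODE`. The bookkeeping half of the soundness of a validated ODE
integrator's transcript (Moore 1979 §8.1, eq. (8.13): "continue the solution beyond with the
interval initial condition"; Nedialkov–Jackson–Corliss 1999, Algorithms I/II), stated ABSTRACTLY
over a per-step enclosure relation so that any per-step validation theorem can be plugged in:
let `0 = τ 0 ≤ τ 1 ≤ … ≤ τ N` be the mesh, `W j` the set of admissible values at `τ j`, and
`Q j s x w` the step-`j` ENCLOSURE RELATION ("`w` is enclosed at relative time `s` for the start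
value `x`", e.g. `w ∈ x + s • f(S j)` for the constant enclosure, or
`w ∈ ∑_{i<K} s^i Φ i x + s^K [c j, d j] ⊆ S j` for the high-order one). IF every step is sound —
(EXISTENCE) from every `x ∈ W j` a solution on `[0, τ (j+1) - τ j]` exists whose values satisfy
`Q j`; (LANDING) `Q j (τ (j+1) - τ j) x w → w ∈ W (j+1)` — THEN from every `y₀ ∈ W 0` a solution
exists on the whole grid `[0, τ N]` with `y (τ j) ∈ W j` and `Q j (t - τ j) (y (τ j)) (y t)` on
each `[τ j, τ (j+1)]` (`exists_solution_of_stepChain`); and if moreover EVERY solution of a step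
satisfies `Q j` (ALL-SOLUTIONS form of the step theorem), then every solution on `[0, τ N]` from
`W 0` is so enclosed (`solution_mem_of_stepChain`; no Lipschitz hypothesis is needed at this
level — it is consumed by the per-step theorem). The order-`K` instances
`exists_solution_of_highOrderChain` / `solution_mem_of_highOrderChain` plug in the high-order
enclosure test of `HighOrderEnclosure.lean` (the order-1 instance is `EnclosureChain.lean`).
The sets `W j` are arbitrary: boxes, parallelepipeds `c + C r₀ + B r` of a QR (Lohner)
representation, or hulls — whatever the verifier checks the landing inclusion for.

## References

* R. E. Moore, *Methods and Applications of Interval Analysis* (SIAM 1979), §8.1, eq. (8.13).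
  [Moore1979]
* N. S. Nedialkov, K. R. Jackson, G. F. Corliss, *Validated solutions of initial value problems
  for ordinary differential equations*, Appl. Math. Comput. 105 (1999) 21–68, §§3–5.
  [NedialkovJacksonCorliss1999]
* N. S. Nedialkov, K. R. Jackson, J. D. Pryce, Reliable Computing 7 (2001) 449–465, §3.
  [NedialkovJacksonPryce2001]
-/

noncomputable section

open Set Metric Filter Topology

open scoped NNReal Nat

namespace Literature.Analysis.ODE

section Abstract

variable {E : Type*} [NormedAddCommGroup E] [NormedSpace ℝ E]

/-- Monotone meshes: `τ i ≤ τ j` for `i ≤ j ≤ M`. [folklore] -/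
private theorem mesh_mono' {τ : ℕ → ℝ} {M : ℕ} (h : ∀ j < M, τ j ≤ τ (j + 1)) {i j : ℕ}
    (hij : i ≤ j) (hjM : j ≤ M) : τ i ≤ τ j := by
  induction j with
  | zero => simp [Nat.le_zero.1 hij]
  | succ j ih =>
    rcases Nat.of_le_succ hij with hij' | hij'
    · exact (ih hij' (Nat.le_of_succ_le hjM)).trans (h j (Nat.lt_of_succ_le hjM))
    · rw [hij']

/-- **Chain of validated steps: existence and enclosure on the whole grid.** Mesh
`0 = τ 0 ≤ … ≤ τ N`, admissible sets `W j`, per-step enclosure relations `Q j`. If from every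
`x ∈ W j` the autonomous equation `y' = f(y)` has a solution `z` on `[0, τ (j+1) - τ j]` with
`z 0 = x` and `Q j s x (z s)` throughout, and `Q j (τ (j+1) - τ j) x w` implies `w ∈ W (j+1)`, then
from every `y₀ ∈ W 0` there is a solution `y` on `[0, τ N]`, `y 0 = y₀`, with `y (τ j) ∈ W j`
(`j ≤ N`) and `Q j (t - τ j) (y (τ j)) (y t)` for `t ∈ [τ j, τ (j+1)]`, `j < N`.
[cite: Moore1979, §8.1 eq. (8.13); NedialkovJacksonCorliss1999, §3] -/
theorem exists_solution_of_stepChain {f : E → E} {τ : ℕ → ℝ} {W : ℕ → Set E}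
    {Q : ℕ → ℝ → E → E → Prop} (N : ℕ) (hτ0 : τ 0 = 0) (hτ : ∀ j < N, τ j ≤ τ (j + 1))
    (hstep : ∀ j < N, ∀ x ∈ W j, ∃ z : ℝ → E, z 0 = x ∧
      (∀ s ∈ Icc 0 (τ (j + 1) - τ j),
        HasDerivWithinAt z (f (z s)) (Icc 0 (τ (j + 1) - τ j)) s) ∧
      ∀ s ∈ Icc 0 (τ (j + 1) - τ j), Q j s x (z s))
    (hland : ∀ j < N, ∀ x ∈ W j, ∀ w, Q j (τ (j + 1) - τ j) x w → w ∈ W (j + 1))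
    {y₀ : E} (hy₀ : y₀ ∈ W 0) :
    ∃ y : ℝ → E, y 0 = y₀ ∧ (∀ t ∈ Icc 0 (τ N), HasDerivWithinAt y (f (y t)) (Icc 0 (τ N)) t) ∧
      (∀ j ≤ N, y (τ j) ∈ W j) ∧
      ∀ j < N, ∀ t ∈ Icc (τ j) (τ (j + 1)), Q j (t - τ j) (y (τ j)) (y t) := by
  induction N with
  | zero =>
    refine ⟨fun _ => y₀, rfl, ?_, ?_, fun j hj => absurd hj (Nat.not_lt_zero j)⟩
    · rw [hτ0]
      exact solution_const (fun _ => f) 0 y₀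
    · intro j hj
      obtain rfl := Nat.le_zero.1 hj
      exact hy₀
  | succ N ih =>
    have hN : N < N + 1 := Nat.lt_succ_self N
    obtain ⟨y, hy0, hy, hyW, hyQ⟩ := ih (fun j hj => hτ j (hj.trans hN))
      (fun j hj => hstep j (hj.trans hN)) (fun j hj => hland j (hj.trans hN))
    have hab : τ N ≤ τ (N + 1) := hτ N hN
    have ha0 : 0 ≤ τ N := by
      have := mesh_mono' hτ (Nat.zero_le N) hN.le
      rwa [hτ0] at this
    have hyN : y (τ N) ∈ W N := hyW N le_rfl
    obtain ⟨u, hu0, hu, huQ⟩ := hstep N hN _ hyN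
    -- the shifted solution `s ↦ u (s - τ N)` on `[τ N, τ (N+1)]` (autonomy)
    have hβ : ∀ t ∈ Icc (τ N) (τ (N + 1)),
        HasDerivWithinAt (fun s => u (s - τ N)) (f (u (t - τ N))) (Icc (τ N) (τ (N + 1))) t := by
      intro t ht
      have h1 := hu (t - τ N) ⟨sub_nonneg.2 ht.1, sub_le_sub_right ht.2 (τ N)⟩
      have h2 : HasDerivWithinAt (fun s => s - τ N) 1 (Icc (τ N) (τ (N + 1))) t :=
        (hasDerivWithinAt_id t _).sub_const (τ N)
      have hmaps : MapsTo (fun s => s - τ N) (Icc (τ N) (τ (N + 1))) (Icc 0 (τ (N + 1) - τ N)) :=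
        fun s hs => ⟨sub_nonneg.2 hs.1, sub_le_sub_right hs.2 (τ N)⟩
      have h3 := h1.scomp t h2 hmaps
      simpa [Function.comp_def] using h3
    have happ := solution_append (v := fun _ => f) (α := y) (β := fun s => u (s - τ N)) hy hβ ha0 hab
      (by simp [hu0])
    refine ⟨fun s => if s ≤ τ N then y s else u (s - τ N), by simp [ha0, hy0], happ, ?_, ?_⟩
    · -- values at the mesh points
      intro j hj
      rcases Nat.of_le_succ hj with hjN | hjN
      · have hja : τ j ≤ τ N := mesh_mono' hτ hjN hN.le
        show (if τ j ≤ τ N then y (τ j) else u (τ j - τ N)) ∈ W j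
        rw [if_pos hja]
        exact hyW j hjN
      · rw [hjN]
        have hmem : u (τ (N + 1) - τ N) ∈ W (N + 1) :=
          hland N hN _ hyN _ (huQ (τ (N + 1) - τ N) ⟨sub_nonneg.2 hab, le_rfl⟩)
        show (if τ (N + 1) ≤ τ N then y (τ (N + 1)) else u (τ (N + 1) - τ N)) ∈ W (N + 1)
        by_cases hba : τ (N + 1) ≤ τ N
        · have hbaeq : τ (N + 1) = τ N := le_antisymm hba hab
          rw [if_pos hba, hbaeq]
          have hu' : u (τ (N + 1) - τ N) = y (τ N) := by rw [hbaeq, sub_self, hu0]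
          rwa [hu'] at hmem
        · rw [if_neg hba]
          exact hmem
    · -- step enclosures
      intro j hj t ht
      rcases Nat.lt_succ_iff_lt_or_eq.1 hj with hjN | hjN
      · have hj1a : τ (j + 1) ≤ τ N := mesh_mono' hτ (Nat.succ_le_of_lt hjN) hN.le
        have hta : t ≤ τ N := ht.2.trans hj1a
        have hja : τ j ≤ τ N := ht.1.trans hta
        show Q j (t - τ j) (if τ j ≤ τ N then y (τ j) else u (τ j - τ N))
          (if t ≤ τ N then y t else u (t - τ N))
        rw [if_pos hta, if_pos hja]
        exact hyQ j hjN t ht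
      · rw [hjN] at ht ⊢
        show Q N (t - τ N) (if τ N ≤ τ N then y (τ N) else u (τ N - τ N))
          (if t ≤ τ N then y t else u (t - τ N))
        rw [if_pos le_rfl]
        by_cases hta : t ≤ τ N
        · have hteq : t = τ N := le_antisymm hta ht.1
          rw [if_pos hta, hteq]
          have h0 := huQ 0 ⟨le_rfl, sub_nonneg.2 hab⟩
          rwa [hu0, ← sub_self (τ N)] at h0
        · rw [if_neg hta]
          exact huQ (t - τ N) ⟨sub_nonneg.2 ht.1, sub_le_sub_right ht.2 (τ N)⟩

/-- **Chain of validated steps: every solution is enclosed.** If for every step `j < N` and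
every `x ∈ W j`, EVERY solution `z` of `z' = f(z)` on `[0, τ (j+1) - τ j]` with `z 0 = x`
satisfies `Q j s x (z s)` throughout, and `Q j (τ (j+1) - τ j) x w → w ∈ W (j+1)`, then every
solution `y` on `[0, τ N]` with `y 0 ∈ W 0` satisfies `y (τ j) ∈ W j` (`j ≤ N`) and
`Q j (t - τ j) (y (τ j)) (y t)` on `[τ j, τ (j+1)]` (`j < N`).
[cite: Moore1979, §8.1 eq. (8.13); NedialkovJacksonCorliss1999, §3] -/
theorem solution_mem_of_stepChain {f : E → E} {τ : ℕ → ℝ} {W : ℕ → Set E}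
    {Q : ℕ → ℝ → E → E → Prop} (N : ℕ) (hτ0 : τ 0 = 0) (hτ : ∀ j < N, τ j ≤ τ (j + 1))
    (hall : ∀ j < N, ∀ x ∈ W j, ∀ z : ℝ → E, z 0 = x →
      (∀ s ∈ Icc 0 (τ (j + 1) - τ j),
        HasDerivWithinAt z (f (z s)) (Icc 0 (τ (j + 1) - τ j)) s) →
      ∀ s ∈ Icc 0 (τ (j + 1) - τ j), Q j s x (z s))
    (hland : ∀ j < N, ∀ x ∈ W j, ∀ w, Q j (τ (j + 1) - τ j) x w → w ∈ W (j + 1))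
    {y : ℝ → E} (hy0 : y 0 ∈ W 0)
    (hy : ∀ t ∈ Icc 0 (τ N), HasDerivWithinAt y (f (y t)) (Icc 0 (τ N)) t) :
    (∀ j ≤ N, y (τ j) ∈ W j) ∧
      ∀ j < N, ∀ t ∈ Icc (τ j) (τ (j + 1)), Q j (t - τ j) (y (τ j)) (y t) := by
  induction N with
  | zero =>
    refine ⟨fun j hj => ?_, fun j hj => absurd hj (Nat.not_lt_zero j)⟩
    obtain rfl := Nat.le_zero.1 hj
    rwa [hτ0]
  | succ N ih =>
    have hN : N < N + 1 := Nat.lt_succ_self N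
    have hab : τ N ≤ τ (N + 1) := hτ N hN
    have ha0 : 0 ≤ τ N := by
      have := mesh_mono' hτ (Nat.zero_le N) hN.le
      rwa [hτ0] at this
    -- restriction to `[0, τ N]`
    have hyres : ∀ t ∈ Icc 0 (τ N), HasDerivWithinAt y (f (y t)) (Icc 0 (τ N)) t := fun t ht =>
      (hy t ⟨ht.1, ht.2.trans hab⟩).mono (Icc_subset_Icc_right hab)
    obtain ⟨hyW, hyQ⟩ := ih (fun j hj => hτ j (hj.trans hN)) (fun j hj => hall j (hj.trans hN))
      (fun j hj => hland j (hj.trans hN)) hyres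
    have hyN : y (τ N) ∈ W N := hyW N le_rfl
    -- the last step, shifted to `[0, τ (N+1) - τ N]`
    have hz : ∀ s ∈ Icc 0 (τ (N + 1) - τ N), HasDerivWithinAt (fun s => y (τ N + s))
        (f (y (τ N + s))) (Icc 0 (τ (N + 1) - τ N)) s := by
      intro s hs
      have h1 := hy (τ N + s) ⟨by linarith [hs.1], by linarith [hs.2]⟩
      have h2 : HasDerivWithinAt (fun s => τ N + s) 1 (Icc 0 (τ (N + 1) - τ N)) s :=
        (hasDerivWithinAt_id s _).const_add (τ N)
      have hmaps : MapsTo (fun s => τ N + s) (Icc 0 (τ (N + 1) - τ N)) (Icc 0 (τ (N + 1))) :=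
        fun r hr => ⟨by linarith [hr.1], by linarith [hr.2]⟩
      have h3 := h1.scomp s h2 hmaps
      simpa [Function.comp_def] using h3
    have hQN : ∀ s ∈ Icc 0 (τ (N + 1) - τ N), Q N s (y (τ N)) (y (τ N + s)) :=
      hall N hN _ hyN (fun s => y (τ N + s)) (by simp) hz
    refine ⟨fun j hj => ?_, fun j hj t ht => ?_⟩
    · rcases Nat.of_le_succ hj with hjN | hjN
      · exact hyW j hjN
      · rw [hjN]
        have h := hland N hN _ hyN _ (hQN (τ (N + 1) - τ N) ⟨sub_nonneg.2 hab, le_rfl⟩)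
        rwa [add_sub_cancel] at h
    · rcases Nat.lt_succ_iff_lt_or_eq.1 hj with hjN | hjN
      · exact hyQ j hjN t ht
      · rw [hjN] at ht ⊢
        have h := hQN (t - τ N) ⟨sub_nonneg.2 ht.1, sub_le_sub_right ht.2 (τ N)⟩
        rwa [add_sub_cancel] at h

end Abstract

/-! ### The order-`K` chain (high-order enclosure steps) -/

section HighOrder

variable {ι : Type*} [Fintype ι]

/-- **A chain of high-order enclosure steps encloses a solution on the whole grid.** Mesh
`0 = τ 0 ≤ … ≤ τ N`; Taylor coefficient functions `Φ i` of `f` on the open `Ω` as in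
`HighOrderEnclosure.lean`; per step `j`: admissible set `W j`, a priori box `S j ⊆ Ω` with
`‖Φ' i‖ ≤ B j` (`i < K`) and `Φ K` Lipschitz into `[c j, d j]` on `S j`, the HOE test
`∑_{i<K} s^i • Φ i x + s^K • v ∈ S j` (`x ∈ W j`, `s ∈ [0, h j]`, `v ∈ [c j, d j]`,
`h j = τ (j+1) - τ j`) and the landing inclusion `∑_{i<K} (h j)^i • Φ i x + (h j)^K • v ∈ W (j+1)`.
Then from every `y₀ ∈ W 0` a solution exists on `[0, τ N]` with `y (τ j) ∈ W j` and, on each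
`[τ j, τ (j+1)]`, `y t ∈ S j` and `y t = ∑_{i<K} (t-τ j)^i • Φ i (y (τ j)) + (t-τ j)^K • v_t`,
`v_t ∈ [c j, d j]`. [cite: NedialkovJacksonPryce2001, §3; Moore1979, §8.1 eq. (8.13)] -/
theorem exists_solution_of_highOrderChain {f : (ι → ℝ) → ι → ℝ}
    {Φ : ℕ → (ι → ℝ) → ι → ℝ} {Φ' : ℕ → (ι → ℝ) → ((ι → ℝ) →L[ℝ] (ι → ℝ))} {Ω : Set (ι → ℝ)}
    {K : ℕ} (hK : 0 < K) {τ : ℕ → ℝ} {W S : ℕ → Set (ι → ℝ)} {L : ℕ → ℝ≥0} {B : ℕ → ℝ}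
    {c d : ℕ → ι → ℝ} (N : ℕ) (hτ0 : τ 0 = 0) (hτ : ∀ j < N, τ j ≤ τ (j + 1))
    (hΦ0 : ∀ x, Φ 0 x = x) (hder : ∀ i < K, ∀ x ∈ Ω, HasFDerivAt (Φ i) (Φ' i x) x)
    (hrec : ∀ i < K, ∀ x ∈ Ω, Φ' i x (f x) = ((i : ℝ) + 1) • Φ (i + 1) x)
    (hSΩ : ∀ j < N, S j ⊆ Ω) (hbd : ∀ j < N, ∀ i < K, ∀ x ∈ S j, ‖Φ' i x‖ ≤ B j)
    (hlipK : ∀ j < N, LipschitzOnWith (L j) (Φ K) (S j)) (hcd : ∀ j < N, c j ≤ d j)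
    (hKS : ∀ j < N, MapsTo (Φ K) (S j) (Icc (c j) (d j)))
    (hincl : ∀ j < N, ∀ x ∈ W j, ∀ s ∈ Icc 0 (τ (j + 1) - τ j), ∀ v ∈ Icc (c j) (d j),
      (∑ i ∈ Finset.range K, s ^ i • Φ i x) + s ^ K • v ∈ S j)
    (hnext : ∀ j < N, ∀ x ∈ W j, ∀ v ∈ Icc (c j) (d j),
      (∑ i ∈ Finset.range K, (τ (j + 1) - τ j) ^ i • Φ i x) + (τ (j + 1) - τ j) ^ K • v ∈ W (j + 1))
    {y₀ : ι → ℝ} (hy₀ : y₀ ∈ W 0) :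
    ∃ y : ℝ → ι → ℝ, y 0 = y₀ ∧
      (∀ t ∈ Icc 0 (τ N), HasDerivWithinAt y (f (y t)) (Icc 0 (τ N)) t) ∧
      (∀ j ≤ N, y (τ j) ∈ W j) ∧
      ∀ j < N, ∀ t ∈ Icc (τ j) (τ (j + 1)), y t ∈ S j ∧ ∃ v ∈ Icc (c j) (d j),
        y t = (∑ i ∈ Finset.range K, (t - τ j) ^ i • Φ i (y (τ j))) + (t - τ j) ^ K • v := by
  refine exists_solution_of_stepChain (W := W)
    (Q := fun j s x w => w ∈ S j ∧ ∃ v ∈ Icc (c j) (d j),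
      w = (∑ i ∈ Finset.range K, s ^ i • Φ i x) + s ^ K • v) N hτ0 hτ (fun j hj x hx => ?_)
    (fun j hj x hx w hw => ?_) hy₀
  · obtain ⟨z, hz0, hz, hzS⟩ := exists_solution_of_highOrderEnclosure hK (hSΩ j hj) hΦ0 hder hrec
      (hbd j hj) (hlipK j hj) (hcd j hj) (hKS j hj) (sub_nonneg.2 (hτ j hj)) (hincl j hj x hx)
    exact ⟨z, hz0, hz, hzS⟩
  · obtain ⟨-, v, hv, rfl⟩ := hw
    exact hnext j hj x hx v hv

/-- **A chain of high-order enclosure steps encloses EVERY solution.** Under the hypotheses of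
`exists_solution_of_highOrderChain` and with `f` Lipschitz on bounded sets, every solution `y`
of `y' = f(y)` on `[0, τ N]` with `y 0 ∈ W 0` satisfies `y (τ j) ∈ W j` (`j ≤ N`) and, on each
`[τ j, τ (j+1)]`, `y t ∈ S j` and `y t = ∑_{i<K} (t-τ j)^i • Φ i (y (τ j)) + (t-τ j)^K • v_t` with
`v_t ∈ [c j, d j]`: the transcript's enclosures contain every solution issued from `W 0`.
[cite: NedialkovJacksonPryce2001, §3; Moore1979, §8.1 eq. (8.13)] -/
theorem solution_mem_of_highOrderChain {f : (ι → ℝ) → ι → ℝ}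
    {Φ : ℕ → (ι → ℝ) → ι → ℝ} {Φ' : ℕ → (ι → ℝ) → ((ι → ℝ) →L[ℝ] (ι → ℝ))} {Ω : Set (ι → ℝ)}
    {K : ℕ} (hK : 0 < K) {τ : ℕ → ℝ} {W S : ℕ → Set (ι → ℝ)} {L : ℕ → ℝ≥0} {B : ℕ → ℝ}
    {c d : ℕ → ι → ℝ} (N : ℕ) (hτ0 : τ 0 = 0) (hτ : ∀ j < N, τ j ≤ τ (j + 1))
    (hΦ0 : ∀ x, Φ 0 x = x) (hder : ∀ i < K, ∀ x ∈ Ω, HasFDerivAt (Φ i) (Φ' i x) x)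
    (hrec : ∀ i < K, ∀ x ∈ Ω, Φ' i x (f x) = ((i : ℝ) + 1) • Φ (i + 1) x)
    (hSΩ : ∀ j < N, S j ⊆ Ω) (hbd : ∀ j < N, ∀ i < K, ∀ x ∈ S j, ‖Φ' i x‖ ≤ B j)
    (hlipK : ∀ j < N, LipschitzOnWith (L j) (Φ K) (S j)) (hcd : ∀ j < N, c j ≤ d j)
    (hKS : ∀ j < N, MapsTo (Φ K) (S j) (Icc (c j) (d j)))
    (hincl : ∀ j < N, ∀ x ∈ W j, ∀ s ∈ Icc 0 (τ (j + 1) - τ j), ∀ v ∈ Icc (c j) (d j),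
      (∑ i ∈ Finset.range K, s ^ i • Φ i x) + s ^ K • v ∈ S j)
    (hnext : ∀ j < N, ∀ x ∈ W j, ∀ v ∈ Icc (c j) (d j),
      (∑ i ∈ Finset.range K, (τ (j + 1) - τ j) ^ i • Φ i x) + (τ (j + 1) - τ j) ^ K • v ∈ W (j + 1))
    (hloc : ∀ ρ : ℝ, ∃ K' : ℝ≥0, LipschitzOnWith K' f (closedBall 0 ρ))
    {y : ℝ → ι → ℝ} (hy0 : y 0 ∈ W 0)
    (hy : ∀ t ∈ Icc 0 (τ N), HasDerivWithinAt y (f (y t)) (Icc 0 (τ N)) t) :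
    (∀ j ≤ N, y (τ j) ∈ W j) ∧
      ∀ j < N, ∀ t ∈ Icc (τ j) (τ (j + 1)), y t ∈ S j ∧ ∃ v ∈ Icc (c j) (d j),
        y t = (∑ i ∈ Finset.range K, (t - τ j) ^ i • Φ i (y (τ j))) + (t - τ j) ^ K • v := by
  refine solution_mem_of_stepChain (W := W)
    (Q := fun j s x w => w ∈ S j ∧ ∃ v ∈ Icc (c j) (d j),
      w = (∑ i ∈ Finset.range K, s ^ i • Φ i x) + s ^ K • v) N hτ0 hτ
    (fun j hj x hx z hz0 hz s hs => ?_) (fun j hj x hx w hw => ?_) hy0 hy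
  · exact solution_mem_of_highOrderEnclosure hK (hSΩ j hj) hΦ0 hder hrec (hbd j hj) (hlipK j hj)
      (hcd j hj) (hKS j hj) (sub_nonneg.2 (hτ j hj)) (hincl j hj x hx) hloc hz0 hz hs
  · obtain ⟨-, v, hv, rfl⟩ := hw
    exact hnext j hj x hx v hv

end HighOrder

end Literature.Analysis.ODE

end
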